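import Summits.QuantumFields.BalabanUV.Beta.D1BFx.RProjectorJetColumns
import Summits.QuantumFields.BalabanUV.Beta.D1BFx.RJetProjector

/-!
# `BalabanUV.Beta.D1BFx.RProjectorJetSocket` — road «BF-x» for binder row D1, leaf J5 (KERNEL LEVEL, part 4, closing): THE RECOGNITION
# SOCKET OF THE TYPED SITE JET, BINDER-FREE — both identities of `ProjectorJetStripped.eq_cojetSkew_iff` for `RProjectorJet.Rdot` on `ℤ⁴`
# with the one bookkeeping binder `Decays (Pgt n a) …` DISCHARGED by leaf-05-g3's `RJetProjector.decays_Pgt` (p212764) BY NAME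

HONEST DEPENDENCY (page 1, mandatory): continuum YM on T⁴ ⇐ BetaPertH ∧ nine spine estimates (0/9 proved); BetaPertH ⇐ (D1) ∧ (D4) ∧
CAP+tail; G-an2-4 gates asym, D1 and NE2/3/4.  HONEST FRAMING: discharging `BetaPertH` makes Bałaban's UV stability UNCONDITIONAL — NOT
the continuum limit and NOT the Clay problem.  THIS FILE DISCHARGES NOTHING of the wall: it is four one-line instantiations of parts 2–3
(`RProjectorJetLeibniz` p212789, `RProjectorJetColumns` p213039) at leaf-05-g3's decay theorem; 0 binders of row D1 touched; no definition,
no cited hypothesis.  Unit `b2b-balaban-beta-d1-formalise-leaf-07` (gen 2).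

CONTENT ([folklore], hypotheses EXACTLY `0 < a` and `[NeZero n]`): with `Ṙ := Rdot n a cK cQ κ′ u`, `P := Pgt n a`, `R := idK − P`,
`G := Ggh n a`, `V := Sgh n cK cQ κ′ u`, `X := Xk n a`, `Q := Qadj n κ′ u`:
* `socket_R : comp R Ṙ + comp Ṙ R = Ṙ` — Leibniz for `R∘R = R`;
* `socket_P : comp P Ṙ + comp Ṙ P = Ṙ`, `socket_PRP : (P∘Ṙ)∘P = 0`, `socket_RRR : (R∘Ṙ)∘R = 0` — off-diagonality (skeleton J5: «block part → A3», no `R·(…)·R` piece);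
* `socket_X : comp Ṙ X + (comp R (comp G Q) − comp R (comp (comp G V) X)) = 0` — Leibniz for `R∘X = 0` along `Ẋ_s = −G∘V∘X + G∘Q`.
-/

namespace Summit.QuantumFields.BalabanUV.Beta.D1BFx.RProjectorJetSocket

open Literature.MathematicalPhysics.QuantumFieldTheory.Balaban1983to89.Beta
open ExpKernelCalculus (Site MKer comp)
open HessKerSchurResolvent (idK)
open GhostLeg (Ggh)
open GhostStencil (Sgh)
open RProjector (Pgt deltaPP deltaPP_pos)
open RProjectorJet (Rdot)
open RProjectorJetColumns (Xk Qadj)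
open RJetProjector (decays_Pgt)

noncomputable section

variable (n : ℕ) [NeZero n] (a cK cQ : ℝ) (κ' : Fin 4) (u : Site 4)

/-- [folklore] The rate of leaf-05-g3's `decays_Pgt` is positive. -/
theorem rate_pos (ha : 0 < a) : 0 < deltaPP 4 a / (4 * (n : ℝ)) := by
  have hn : (0 : ℝ) < n := Nat.cast_pos.mpr (Nat.pos_of_ne_zero (NeZero.ne n))
  have := deltaPP_pos 4 ha
  positivity

/-- [folklore] **`R∘Ṙ + Ṙ∘R = Ṙ`** for the typed site jet, binder-free (`R = idK − Pgt n a`). -/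
theorem socket_R (ha : 0 < a) :
    comp (idK - Pgt n a) (Rdot n a cK cQ κ' u) + comp (Rdot n a cK cQ κ' u) (idK - Pgt n a) = Rdot n a cK cQ κ' u :=
  RProjectorJetLeibniz.leibniz_R_Rdot n a cK cQ κ' u ha (rate_pos n a ha) (decays_Pgt n a ha)

/-- [folklore] **`P∘Ṙ + Ṙ∘P = Ṙ`**, binder-free. -/
theorem socket_P (ha : 0 < a) :
    comp (Pgt n a) (Rdot n a cK cQ κ' u) + comp (Rdot n a cK cQ κ' u) (Pgt n a) = Rdot n a cK cQ κ' u :=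
  RProjectorJetLeibniz.leibniz_P_Rdot n a cK cQ κ' u ha (rate_pos n a ha) (decays_Pgt n a ha)

/-- [folklore] **`(P∘Ṙ)∘P = 0`**, binder-free. -/
theorem socket_PRP (ha : 0 < a) : comp (comp (Pgt n a) (Rdot n a cK cQ κ' u)) (Pgt n a) = 0 :=
  RProjectorJetLeibniz.Pgt_Rdot_Pgt n a cK cQ κ' u ha (rate_pos n a ha) (decays_Pgt n a ha)

/-- [folklore] **`(R∘Ṙ)∘R = 0`**, binder-free. -/
theorem socket_RRR (ha : 0 < a) : comp (comp (idK - Pgt n a) (Rdot n a cK cQ κ' u)) (idK - Pgt n a) = 0 :=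
  RProjectorJetLeibniz.R_Rdot_R n a cK cQ κ' u ha (rate_pos n a ha) (decays_Pgt n a ha)

/-- [folklore] **`Ṙ∘X + R∘Ẋ_s = 0`** for the typed site jet against the typed columns `X = G′Q′*` and the stripped variation
`Ẋ_s = −G∘V∘X + G∘Q`, binder-free. -/
theorem socket_X (ha : 0 < a) :
    comp (Rdot n a cK cQ κ' u) (Xk n a) +
      (comp (idK - Pgt n a) (comp (Ggh n a) (Qadj n κ' u)) -
        comp (idK - Pgt n a) (comp (comp (Ggh n a) (Sgh n cK cQ κ' u)) (Xk n a))) = 0 :=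
  RProjectorJetColumns.leibniz_X_Rdot n a cK cQ κ' u ha (rate_pos n a ha) (decays_Pgt n a ha)

end

end Summit.QuantumFields.BalabanUV.Beta.D1BFx.RProjectorJetSocket
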